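import Literature.Analysis.FluidPDE.Wei2016SwirlFourIdentity
import Literature.Analysis.FluidPDE.HouLiVariablesMemLp
import Literature.Analysis.FluidPDE.TaoClassGlue
import HarnessLib

/-!
# The `L⁴` slice inequality of `v^θ` in Tao's class:
# `∫ σΦ³Φ' + ν ∫ ρΦ⁴ ≤ ‖vʳ/r‖_∞ ∫ σΦ⁴`

Analysis/FluidPDE proof file (theorems only; no definitions, no named facts) on the way to
`Literature.Analysis.FluidPDE.Wei2016_logModulus_regularity`
(`LeiZhang2017AxisymmetricCriteria.lean`): the fixed-time `L⁴` estimate of `v^θ`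
(Lei–Zhang 2017, §3 p. 9; end of the proof of Wei 2016, Thm. 1.1) of
`Wei2016SwirlFourIdentity` (`IsClassicalNSSolutionOn.integral_rhoSq_mul_angVelQuot_cube_le`)
with all the square-integrability and boundedness hypotheses discharged from Tao's class
(`IsTaoSolutionOn`: `H^∞` bounds of `u(τ)` and `∂ₜu(τ)` on the slab):

* `IsTaoSolutionOn.swirlFour_slice_le` — for a Tao-class solution on `[0, T]` (`ν ≥ 0`) with
  axisymmetric slices, `τ ∈ [0, T]`, and any bound `|vʳ/r| = |radVelQuot (u τ)| ≤ W_∞`,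
  `∫ (x₀²+x₁²)²Φ³Φ' + ν ∫ (x₀²+x₁²)Φ⁴ ≤ W_∞ ∫ (x₀²+x₁²)²Φ⁴`
  (`Φ = angVelQuot (u τ)`, `Φ' = angVelQuot (∂ₜu τ)`; `(v^θ)⁴ = (x₀²+x₁²)²Φ⁴`,
  `(v^θ)⁴/r² = (x₀²+x₁²)Φ⁴`), i.e. `d/dt‖v^θ‖⁴_{L⁴} + 4ν‖r⁻¹(v^θ)²‖² ≤ 4‖vʳ/r‖_∞‖v^θ‖⁴_{L⁴}`.

## References

* Z. Lei, Q. S. Zhang, arXiv:1505.02628, §3 p. 9. [LeiZhang2017]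
* D. Wei, arXiv:1508.03318, end of the proof of Thm. 1.1. [Wei2016]
-/

noncomputable section

open MeasureTheory Set Function Filter Topology InnerProductSpace
open scoped RealInnerProductSpace ContDiff ENNReal

namespace Literature.Analysis.FluidPDE

variable {T ν : ℝ} {u₀ : EuclideanSpace ℝ (Fin 3) → EuclideanSpace ℝ (Fin 3)}
  {u : ℝ → EuclideanSpace ℝ (Fin 3) → EuclideanSpace ℝ (Fin 3)} {p : ℝ → EuclideanSpace ℝ (Fin 3) → ℝ}

set_option maxHeartbeats 800000 in
/-- **The `L⁴` slice inequality of `v^θ` in Tao's class** (Lei–Zhang 2017, §3 p. 9; Wei 2016,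
end of the proof of Thm. 1.1): for a Tao-class solution on `[0, T]` with viscosity `ν ≥ 0` and
axisymmetric slices, `τ ∈ [0, T]`, and `|radVelQuot (u τ)| ≤ W_∞`,
`∫ (x₀²+x₁²)²Φ³Φ' + ν ∫ (x₀²+x₁²)Φ⁴ ≤ W_∞ ∫ (x₀²+x₁²)²Φ⁴`. [cite: LeiZhang2017, §3 p. 9] -/
theorem IsTaoSolutionOn.swirlFour_slice_le (h : IsTaoSolutionOn T ν u₀ u p) (hν : 0 ≤ ν) (hT : 0 < T)
    (hax : ∀ t ∈ Icc 0 T, IsAxisymmetric (u t)) {τ : ℝ} (hτ : τ ∈ Icc 0 T)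
    {Wsup : ℝ} (hWsup : ∀ x, |radVelQuot (u τ) x| ≤ Wsup) :
    (∫ x : EuclideanSpace ℝ (Fin 3), (x 0 ^ 2 + x 1 ^ 2) ^ 2 * angVelQuot (u τ) x ^ 3 *
        angVelQuot (FluidPDE.timeDerivWithin (Icc 0 T) u τ) x) +
        ν * ∫ x : EuclideanSpace ℝ (Fin 3), (x 0 ^ 2 + x 1 ^ 2) * angVelQuot (u τ) x ^ 4 ≤
      Wsup * ∫ x : EuclideanSpace ℝ (Fin 3), (x 0 ^ 2 + x 1 ^ 2) ^ 2 * angVelQuot (u τ) x ^ 4 := by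
  have hcl := h.classical
  have hsm : IsSmoothSpaceTimeOn (Icc 0 T) u := hcl.smooth_velocity
  have hU : UniqueDiffOn ℝ (Icc 0 T) := uniqueDiffOn_Icc hT
  have hu : ContDiff ℝ ∞ (u τ) := hcl.contDiff_velocity hτ
  have haxτ : IsAxisymmetric (u τ) := hax τ hτ
  have hH : ∀ n : ℕ, ∫⁻ x, ‖iteratedFDeriv ℝ n (u τ) x‖ₑ ^ 2 < ⊤ := fun n => by
    obtain ⟨C, hC⟩ := h.sobolev n; exact (hC τ hτ).trans_lt ENNReal.coe_lt_top
  have hut : ContDiff ℝ ∞ (FluidPDE.timeDerivWithin (Icc 0 T) u τ) := hsm.contDiff_timeDerivWithin_slice hU hτ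
  have hHt : ∀ n : ℕ, ∫⁻ x, ‖iteratedFDeriv ℝ n (FluidPDE.timeDerivWithin (Icc 0 T) u τ) x‖ₑ ^ 2 < ⊤ := fun n => by
    obtain ⟨C, hC⟩ := h.sobolev_dt n; exact (hC τ hτ).trans_lt ENNReal.coe_lt_top
  obtain ⟨B, -, hB⟩ := h.exists_bound_velocity
  obtain ⟨B1, -, hB1⟩ := h.sobolev.exists_forall_norm_iteratedFDeriv_le (fun t ht => hcl.contDiff_velocity ht) 1
  have hDb : ∀ x, ‖fderiv ℝ (u τ) x‖ ≤ B1 := fun x => by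
    have := hB1 τ hτ x
    rwa [← norm_iteratedFDeriv_fderiv (n := 0), norm_iteratedFDeriv_zero] at this
  -- the quotient `Φ` and its Sobolev atoms
  have hΦ : ContDiff ℝ ∞ (angVelQuot (u τ)) := contDiff_angVelQuot_of_contDiff hu
  have hΦfin := haxτ.lintegral_sq_iteratedFDeriv_angVelQuot_lt_top hu hH
  have hne := norm_euclideanSpace_single_one_le
  have m0Φ : MemLp (angVelQuot (u τ)) 2 volume := memLp_of_sobolev hΦ hΦfin
  have m1Φ : ∀ i : Fin 3, MemLp (fun x => fderiv ℝ (angVelQuot (u τ)) x (EuclideanSpace.single i 1)) 2 volume :=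
    fun i => memLp_fderiv_apply_of_sobolev hΦ hΦfin (hne i)
  -- `L²` atoms of `u τ`, `∂ₜu τ`
  have mD : ∀ n : ℕ, MemLp (fun x => ‖iteratedFDeriv ℝ n (u τ) x‖) 2 volume := fun n =>
    memLp_two_of_norm_le_of_lintegral (hu.continuous_iteratedFDeriv (by exact_mod_cast le_top)).norm
      (fun x => by rw [norm_norm]) (hH n)
  have hv0 : MemLp (u τ) 2 volume :=
    memLp_two_of_norm_le_of_lintegral hu.continuous
      (fun x => (norm_iteratedFDeriv_zero (𝕜 := ℝ) (f := u τ) (x := x)).symm.le) (hH 0)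
  have hvt : MemLp (FluidPDE.timeDerivWithin (Icc 0 T) u τ) 2 volume :=
    memLp_two_of_norm_le_of_lintegral hut.continuous
      (fun x => (norm_iteratedFDeriv_zero (𝕜 := ℝ) (f := FluidPDE.timeDerivWithin (Icc 0 T) u τ) (x := x)).symm.le)
      (hHt 0)
  have hv1 : MemLp (fun x => fderiv ℝ (u τ) x) 2 volume := by
    refine memLp_of_norm_le_const_mul (hu.continuous_fderiv (by simp)) zero_le_one (fun x => ?_) (mD 1)
    rw [one_mul, ← norm_iteratedFDeriv_fderiv (n := 0), norm_iteratedFDeriv_zero]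
  have hv2 : ∀ i : Fin 3, MemLp (fun x => fderiv ℝ (fun y => fderiv ℝ (u τ) y (EuclideanSpace.single i 1)) x) 2 volume := by
    intro i
    have hui : ContDiff ℝ ∞ fun y => fderiv ℝ (u τ) y (EuclideanSpace.single i 1) :=
      contDiff_fderiv_apply_vec3_of_contDiff hu _
    refine memLp_of_norm_le_const_mul (hui.continuous_fderiv (by simp)) zero_le_one (fun x => ?_) (mD 2)
    rw [one_mul]
    have h1 := norm_iteratedFDeriv_fderiv_apply_le_vec3 hu (EuclideanSpace.single i (1 : ℝ)) 1 x
    rw [norm_iteratedFDeriv_fderiv (n := 0) |>.symm, norm_iteratedFDeriv_zero] at h1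
    calc ‖fderiv ℝ (fun y => fderiv ℝ (u τ) y (EuclideanSpace.single i 1)) x‖ ≤
        ‖(EuclideanSpace.single i (1 : ℝ) : EuclideanSpace ℝ (Fin 3))‖ * ‖iteratedFDeriv ℝ 2 (u τ) x‖ := h1
      _ ≤ 1 * ‖iteratedFDeriv ℝ 2 (u τ) x‖ := mul_le_mul_of_nonneg_right (hne i) (norm_nonneg _)
      _ = ‖iteratedFDeriv ℝ 2 (u τ) x‖ := one_mul _
  have hmain := hcl.integral_rhoSq_mul_angVelQuot_cube_le hν hU hax hτ m0Φ m1Φ hv0 hvt hv1 hv2 (hB τ hτ) hDb hWsup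
  exact hmain

end Literature.Analysis.FluidPDE

end
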